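import Mathlib
import HarnessLib

/-!
# The augmentation ideal of a ring endomorphism (Király–Lütkebohmert)

Topic: `Literature/AlgebraicGeometry/Resolution` (definition request `defn-AugmentationIdealLoewyFlag`,
route WildQuotient, support item `KiralyLutkebohmertCriterion`; idea card
tame-ghost-of-a-wild-action-v2 §D1). Companion file: `LoewyFlag.lean` (the higher augmentation
ideals `((σ - 1)^j B) · B`, their nilpotency in characteristic `p` and the trace formula).

Let `B` be a commutative ring and `σ` a ring endomorphism of `B` — any `FunLike` type with a
`RingHomClass` instance (`B ≃+* B`, `B →+* B`, `B ≃ₐ[k] B`, …), so that `augIdeal σ` unfolds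
literally to `Ideal.span (Set.range fun b => σ b - b)` for `σ : B ≃+* B`. Király–Lütkebohmert
[KiralyLutkebohmert2013, §1, p. 64] attach to `σ` (there: a generator of a cyclic group `G` of prime
order `p` acting on a normal local ring `B`) the

* **augmentation map** `I := I_σ := σ - id : B → B`, `b ↦ σ b - b` — here `augMap σ : B →+ B`,
  defined as `(σ : B →+ B) - AddMonoidHom.id B`;
* **augmentation ideal** `I_G := (I(b) ; b ∈ B) · B`, the ideal generated by the image `I(B)` —
  here `augIdeal σ := Ideal.span (Set.range fun b => σ b - b)`;
* **augmentation generator**: an element `y` with `I_G = B · I(y)` — here `IsAugGenerator σ y`.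

## Main statements (all PROVED; no named facts are introduced)

* `augMap_mul` — twisted Leibniz rule `I(b₁ b₂) = I(b₁) σ(b₂) + b₁ I(b₂)`
  [KiralyLutkebohmert2013, Remark 3 (i)]; `augMap_pow` — `I(bⁿ) = (∑ σ(b)^i b^(n-1-i)) · I(b)`
  [KiralyLutkebohmert2013, Remark 3 (ii)]; `augMap_mul_of_apply_eq` — `I` is linear over the
  fixed ring; `apply_mem_augIdeal_of_mem` — `I_G` is `σ`-stable.
* `exists_isAugGenerator_of_isPrincipal` — over a local ring a principal augmentation ideal has an
  augmentation generator (Nakayama) [KiralyLutkebohmert2013, §1, p. 64].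
* `iterate_sub_mem_augIdeal`, `augIdeal_pow_le`, `augIdeal_pow_eq_of_coprime` — the augmentation
  ideal does not depend on the chosen generator of `⟨σ⟩` [KiralyLutkebohmert2013, §1, p. 64: "Note
  that this ideal does not depend on the chosen generator σ of G"].
* `map_augIdeal_of_isLocalization` — if `σ` extends to `τ` on a localisation `S⁻¹B`, then
  `I_σ · S⁻¹B = I_τ`; the computation is the fraction formula
  `I(b₁/b₂) = (I(b₁) b₂ - b₁ I(b₂)) / (b₂ σ(b₂))` of [KiralyLutkebohmert2013, Remark 3 (iii)];
  `iterate_augMap_mk'_of_isLocalization` — `(τ - id)^j (b/s) = ((σ - id)^j b)/s` for `σ`-invariant `s`.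

## Sources

* F. Király, W. Lütkebohmert, *Group actions of prime order on local normal rings*, Algebra &
  Number Theory 7 (2013) 63–74, doi:10.2140/ant.2013.7.63, §1 (p. 64) and Remark 3 (p. 65).
  [KiralyLutkebohmert2013]

Not here: Theorem 2 of loc. cit. (principal augmentation ideal ⇔ monogenous ⇒ free; for `B`
regular: free ⇔ invariants regular), which is the route's support item `KiralyLutkebohmertCriterion`.
-/

namespace Literature.AlgebraicGeometry.Resolution

open Function

variable {B : Type*} [CommRing B]
variable {F : Type*} [FunLike F B B]

/-! ## The augmentation map -/

section AugMap

variable [AddMonoidHomClass F B B]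

/-- The **augmentation map** of `σ`: the additive map `I_σ := σ - id`, `b ↦ σ b - b`
[cite: KiralyLutkebohmert2013, §1 p. 64]. -/
def augMap (σ : F) : B →+ B :=
  (σ : B →+ B) - AddMonoidHom.id B

/-- `I_σ(b) = σ b - b` [cite: KiralyLutkebohmert2013, §1 p. 64]. -/
@[simp]
theorem augMap_apply (σ : F) (b : B) : augMap σ b = σ b - b := rfl

/-- `I_σ(b) = 0` iff `b` is fixed by `σ` [cite: KiralyLutkebohmert2013, §1 p. 64]. -/
theorem augMap_eq_zero_iff {σ : F} {b : B} : augMap σ b = 0 ↔ σ b = b := sub_eq_zero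

/-- `σ = id + I_σ` [cite: KiralyLutkebohmert2013, §1 p. 64]. -/
theorem apply_eq_add_augMap (σ : F) (b : B) : σ b = b + augMap σ b := by
  rw [augMap_apply, add_sub_cancel]

end AugMap

/-! ## The augmentation ideal -/

/-- The **augmentation ideal** of `σ`: the ideal `I_G := (σ b - b ; b ∈ B) · B` generated by the
image of the augmentation map [cite: KiralyLutkebohmert2013, §1 p. 64]. -/
def augIdeal (σ : F) : Ideal B :=
  Ideal.span (Set.range fun b => σ b - b)

/-- Unfolding lemma: `augIdeal σ = Ideal.span (Set.range fun b => σ b - b)`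
[cite: KiralyLutkebohmert2013, §1 p. 64]. -/
theorem augIdeal_def (σ : F) : augIdeal σ = Ideal.span (Set.range fun b : B => σ b - b) := rfl

/-- The generators `σ b - b` lie in the augmentation ideal [cite: KiralyLutkebohmert2013, §1 p. 64]. -/
theorem sub_mem_augIdeal (σ : F) (b : B) : σ b - b ∈ augIdeal σ :=
  Ideal.subset_span ⟨b, rfl⟩

/-- `σ^[n] b - b ∈ I_G` for every `n` (telescoping sum): the augmentation ideal of a power of `σ` is
contained in that of `σ` [cite: KiralyLutkebohmert2013, §1 p. 64]. -/
theorem iterate_sub_mem_augIdeal (σ : F) (n : ℕ) (b : B) : (⇑σ)^[n] b - b ∈ augIdeal σ := by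
  induction n with
  | zero => simp
  | succ n ih =>
    rw [iterate_succ_apply']
    have h : σ ((⇑σ)^[n] b) - b = (σ ((⇑σ)^[n] b) - (⇑σ)^[n] b) + ((⇑σ)^[n] b - b) := by ring
    rw [h]
    exact add_mem (sub_mem_augIdeal σ _) ih

section AugIdeal

variable [AddMonoidHomClass F B B]

/-- `augIdeal σ` is the ideal generated by the image of `augMap σ`
[cite: KiralyLutkebohmert2013, §1 p. 64]. -/
theorem augIdeal_eq_span_range_augMap (σ : F) :
    augIdeal σ = Ideal.span (Set.range (augMap σ)) := rfl

/-- `I_σ(b) ∈ I_G` [cite: KiralyLutkebohmert2013, §1 p. 64]. -/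
theorem augMap_mem_augIdeal (σ : F) (b : B) : augMap σ b ∈ augIdeal σ :=
  sub_mem_augIdeal σ b

end AugIdeal

/-! ## Augmentation generators -/

/-- An **augmentation generator** for `σ` is an element `y` such that the augmentation ideal is
generated by `I(y) = σ y - y` [cite: KiralyLutkebohmert2013, §1 p. 64]. -/
def IsAugGenerator (σ : F) (y : B) : Prop :=
  augIdeal σ = Ideal.span {σ y - y}

/-- Unfolding lemma for `IsAugGenerator` [cite: KiralyLutkebohmert2013, §1 p. 64]. -/
theorem isAugGenerator_iff (σ : F) (y : B) :
    IsAugGenerator σ y ↔ augIdeal σ = Ideal.span {σ y - y} := Iff.rfl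

/-- If `σ` has an augmentation generator, its augmentation ideal is principal (condition (a) of
[cite: KiralyLutkebohmert2013, Thm 2]). -/
theorem IsAugGenerator.isPrincipal {σ : F} {y : B} (h : IsAugGenerator σ y) :
    (augIdeal σ).IsPrincipal :=
  ⟨⟨σ y - y, by rw [h, Ideal.submodule_span_eq]⟩⟩

/-- **In a local ring, a principal augmentation ideal has an augmentation generator**: "Since `B`
is local, the ideal `I_G` is generated by an augmentation generator if `I_G` is principal. Namely,
`I_G/𝔪_B I_G` is a vector space over the residue field of dimension 1, so it is generated by the
residue class of `I(y)` for some `y ∈ B`, and hence, by Nakayama's lemma, `I_G` is generated by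
`I(y)`" [cite: KiralyLutkebohmert2013, §1 p. 64]. (Proof here: if every `I(b)` lies in `𝔪_B I_G`
then `I_G = 𝔪_B I_G = 0` by Nakayama; otherwise some `I(y) = c · x`, `x` a generator, has `c` a
unit.) -/
theorem exists_isAugGenerator_of_isPrincipal [IsLocalRing B] (σ : F)
    (h : (augIdeal σ).IsPrincipal) : ∃ y, IsAugGenerator σ y := by
  obtain ⟨x, hx⟩ := Submodule.IsPrincipal.principal (augIdeal σ)
  by_cases hall : ∀ b : B, σ b - b ∈ IsLocalRing.maximalIdeal B • augIdeal σ
  · -- every generator lies in `𝔪 I`, so `I ≤ 𝔪 I` and `I = 0` by Nakayama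
    have hle : augIdeal σ ≤ IsLocalRing.maximalIdeal B • augIdeal σ :=
      Ideal.span_le.2 (by rintro _ ⟨b, rfl⟩; exact hall b)
    have hbot : augIdeal σ = ⊥ :=
      Submodule.eq_bot_of_le_smul_of_le_jacobson_bot _ _
        ⟨{x}, by rw [Finset.coe_singleton]; exact hx.symm⟩ hle
        (IsLocalRing.maximalIdeal_le_jacobson _)
    refine ⟨0, ?_⟩
    have h0 : σ (0 : B) - 0 = 0 := by
      simpa only [hbot, Ideal.mem_bot] using sub_mem_augIdeal σ (0 : B)
    rw [IsAugGenerator, hbot, h0, eq_comm, Ideal.span_singleton_eq_bot]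
  · push Not at hall
    obtain ⟨y, hy⟩ := hall
    refine ⟨y, ?_⟩
    have hyI : σ y - y ∈ augIdeal σ := sub_mem_augIdeal σ y
    rw [hx] at hyI
    obtain ⟨c, hc⟩ := Ideal.mem_span_singleton'.1 hyI
    have hcu : IsUnit c := by
      by_contra hcu
      apply hy
      rw [← hc]
      exact Submodule.smul_mem_smul ((IsLocalRing.mem_maximalIdeal c).2 hcu)
        (hx ▸ Ideal.mem_span_singleton_self x)
    rw [IsAugGenerator, hx, ← hc]
    exact (Ideal.span_singleton_mul_left_unit hcu x).symm

/-! ## Twisted Leibniz rule [KiralyLutkebohmert2013, Remark 3] -/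

section Leibniz

variable [RingHomClass F B B]

/-- **Twisted Leibniz rule** `I(b₁ b₂) = I(b₁) σ(b₂) + b₁ I(b₂)`
[cite: KiralyLutkebohmert2013, Remark 3 (i)]. -/
theorem augMap_mul (σ : F) (b₁ b₂ : B) :
    augMap σ (b₁ * b₂) = augMap σ b₁ * σ b₂ + b₁ * augMap σ b₂ := by
  simp only [augMap_apply, map_mul]
  ring

/-- Symmetric form of the twisted Leibniz rule: `I(b₁ b₂) = I(b₁) b₂ + b₁ I(b₂) + I(b₁) I(b₂)`
[cite: KiralyLutkebohmert2013, Remark 3 (i)]. -/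
theorem augMap_mul' (σ : F) (b₁ b₂ : B) :
    augMap σ (b₁ * b₂) = augMap σ b₁ * b₂ + b₁ * augMap σ b₂ + augMap σ b₁ * augMap σ b₂ := by
  simp only [augMap_apply, map_mul]
  ring

/-- `I(bⁿ) = (∑_{i<n} σ(b)^i b^(n-1-i)) · I(b)` [cite: KiralyLutkebohmert2013, Remark 3 (ii)]. -/
theorem augMap_pow (σ : F) (b : B) (n : ℕ) :
    augMap σ (b ^ n) = (∑ i ∈ Finset.range n, σ b ^ i * b ^ (n - 1 - i)) * augMap σ b := by
  simp only [augMap_apply, map_pow]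
  exact (geom_sum₂_mul (σ b) b n).symm

/-- The augmentation map is linear over the fixed ring: `I(a b) = a I(b)` if `σ a = a` ("`I` is
`A`-linear", `A = B^G`) [cite: KiralyLutkebohmert2013, proof of Prop. 6]. -/
theorem augMap_mul_of_apply_eq (σ : F) {a : B} (ha : σ a = a) (b : B) :
    augMap σ (a * b) = a * augMap σ b := by
  rw [augMap_mul, augMap_eq_zero_iff.2 ha, zero_mul, zero_add]

/-- Iterated form: `I^[j](b a) = I^[j](b) a` if `σ a = a`
[cite: KiralyLutkebohmert2013, proof of Prop. 6]. -/
theorem iterate_augMap_mul_of_apply_eq (σ : F) {a : B} (ha : σ a = a) (j : ℕ) (b : B) :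
    (⇑(augMap σ))^[j] (b * a) = (⇑(augMap σ))^[j] b * a := by
  induction j generalizing b with
  | zero => rfl
  | succ j ih => rw [iterate_succ_apply, iterate_succ_apply, mul_comm b a,
      augMap_mul_of_apply_eq σ ha, mul_comm a, ih]

/-- `I(B)` is stable under multiplication by fixed elements, so `I_G` is already generated by
`I(B)` over the fixed ring [cite: KiralyLutkebohmert2013, proof of Prop. 6]. -/
theorem mul_augMap_mem_range (σ : F) {a : B} (ha : σ a = a) (b : B) :
    a * augMap σ b ∈ Set.range (augMap σ) :=
  ⟨a * b, augMap_mul_of_apply_eq σ ha b⟩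

/-- The augmentation map preserves the augmentation ideal: `I(I_G) ⊆ I_G`, by
`I(a · I(b)) = I(I(b)) σ(a) + I(b) I(a)` [cite: KiralyLutkebohmert2013, Remark 3 (i)]. -/
theorem augMap_mem_augIdeal_of_mem (σ : F) {x : B} (hx : x ∈ augIdeal σ) :
    augMap σ x ∈ augIdeal σ := by
  induction hx using Submodule.span_induction with
  | mem y hy =>
    obtain ⟨b, rfl⟩ := hy
    exact augMap_mem_augIdeal σ _
  | zero => simp
  | add y z _ _ ihy ihz =>
    rw [map_add]
    exact add_mem ihy ihz
  | smul a y hy ih =>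
    rw [smul_eq_mul, mul_comm, augMap_mul]
    exact add_mem (Ideal.mul_mem_right _ _ ih) (Ideal.mul_mem_right _ _ hy)

/-- The augmentation ideal is `σ`-stable [cite: KiralyLutkebohmert2013, §1 p. 64]. -/
theorem apply_mem_augIdeal_of_mem (σ : F) {x : B} (hx : x ∈ augIdeal σ) : σ x ∈ augIdeal σ := by
  rw [apply_eq_add_augMap σ x]
  exact add_mem hx (augMap_mem_augIdeal_of_mem σ hx)

end Leibniz

/-! ## Ring automorphisms of finite order: independence of the generator -/

section RingAut

/-- For a ring automorphism, `augIdeal (σ ^ n) ≤ augIdeal σ`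
[cite: KiralyLutkebohmert2013, §1 p. 64]. -/
theorem augIdeal_pow_le (σ : B ≃+* B) (n : ℕ) : augIdeal (σ ^ n) ≤ augIdeal σ := by
  refine Ideal.span_le.2 ?_
  rintro _ ⟨b, rfl⟩
  simp only [RingAut.coe_pow]
  exact iterate_sub_mem_augIdeal σ n b

/-- **The augmentation ideal does not depend on the generator**: if `σ ^ p = 1` and `i` is prime
to `p`, then `augIdeal (σ ^ i) = augIdeal σ` [cite: KiralyLutkebohmert2013, §1 p. 64]. -/
theorem augIdeal_pow_eq_of_coprime (σ : B ≃+* B) {p i : ℕ} (hσ : σ ^ p = 1)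
    (hi : i.Coprime p) : augIdeal (σ ^ i) = augIdeal σ := by
  refine le_antisymm (augIdeal_pow_le σ i) ?_
  rcases Nat.lt_or_ge 1 p with hp | hp
  · obtain ⟨k, -, hk⟩ := Nat.exists_mul_mod_eq_one_of_coprime hi hp
    have hσ' : (σ ^ i) ^ k = σ := by
      rw [← pow_mul, ← Nat.div_add_mod (i * k) p, hk, pow_add, pow_mul, hσ, one_pow, one_mul,
        pow_one]
    calc augIdeal σ = augIdeal ((σ ^ i) ^ k) := by rw [hσ']
      _ ≤ augIdeal (σ ^ i) := augIdeal_pow_le _ k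
  · interval_cases p
    · rw [Nat.coprime_zero_right] at hi
      rw [hi, pow_one]
    · rw [pow_one] at hσ
      rw [hσ, one_pow]

end RingAut

/-! ## Behaviour under localisation -/

section Localization

variable {L : Type*} [CommRing L] [Algebra B L]
variable {G : Type*} [FunLike G L L] [RingHomClass G L L]

/-- **The augmentation ideal localises.** Let `L = S⁻¹B` and let `τ` be a ring endomorphism of
`L` extending `σ` (`τ (b/1) = σ(b)/1`). Then `I_σ · L = I_τ`. The inclusion `⊇` is the formula
`I(b₁/b₂) = (I(b₁) b₂ - b₁ I(b₂)) / (b₂ σ(b₂))` of [cite: KiralyLutkebohmert2013, Remark 3 (iii)]. -/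
theorem map_augIdeal_of_isLocalization (S : Submonoid B) [IsLocalization S L] (σ : F) (τ : G)
    (h : ∀ b, τ (algebraMap B L b) = algebraMap B L (σ b)) :
    (augIdeal σ).map (algebraMap B L) = augIdeal τ := by
  apply le_antisymm
  · rw [augIdeal, Ideal.map_span]
    refine Ideal.span_le.2 ?_
    rintro _ ⟨_, ⟨b, rfl⟩, rfl⟩
    rw [map_sub, ← h]
    exact sub_mem_augIdeal τ _
  · refine Ideal.span_le.2 ?_
    rintro _ ⟨x, rfl⟩
    obtain ⟨b, s, rfl⟩ := IsLocalization.exists_mk'_eq S x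
    have hu : IsUnit (algebraMap B L s * algebraMap B L (σ s)) := by
      refine (IsLocalization.map_units L s).mul ?_
      rw [← h]
      exact (IsLocalization.map_units L s).map τ
    rw [SetLike.mem_coe, ← Ideal.mul_unit_mem_iff_mem _ hu]
    have hx : IsLocalization.mk' L b s * algebraMap B L s = algebraMap B L b :=
      IsLocalization.mk'_spec L b s
    have hτx : τ (IsLocalization.mk' L b s) * algebraMap B L (σ s) = algebraMap B L (σ b) := by
      rw [← h, ← map_mul, hx, h]
    have key : (τ (IsLocalization.mk' L b s) - IsLocalization.mk' L b s) *
        (algebraMap B L s * algebraMap B L (σ s)) =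
        algebraMap B L ((σ b - b) * s - b * (σ s - s)) := by
      calc (τ (IsLocalization.mk' L b s) - IsLocalization.mk' L b s) *
            (algebraMap B L s * algebraMap B L (σ s))
          = τ (IsLocalization.mk' L b s) * algebraMap B L (σ s) * algebraMap B L s -
            IsLocalization.mk' L b s * algebraMap B L s * algebraMap B L (σ s) := by ring
        _ = algebraMap B L ((σ b - b) * s - b * (σ s - s)) := by
          rw [hτx, hx]
          simp only [map_sub, map_mul]
          ring
    rw [key]
    exact Ideal.mem_map_of_mem _ (sub_mem (Ideal.mul_mem_right _ _ (sub_mem_augIdeal σ b))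
      (Ideal.mul_mem_left _ _ (sub_mem_augIdeal σ (s : B))))

variable [RingHomClass F B B]

/-- If `σ` on `B` and `τ` on `L` are compatible with `algebraMap B L`, then so are all iterates of
their augmentation maps [folklore]. -/
theorem semiconj_iterate_augMap {σ : F} {τ : G}
    (h : ∀ b, τ (algebraMap B L b) = algebraMap B L (σ b)) (j : ℕ) (b : B) :
    algebraMap B L ((⇑(augMap σ))^[j] b) = (⇑(augMap τ))^[j] (algebraMap B L b) := by
  have hs : Semiconj (algebraMap B L) (augMap σ) (augMap τ) := fun b => by
    rw [augMap_apply, augMap_apply, map_sub, h]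
  exact hs.iterate_right j b

/-- On a localisation with `σ`-invariant denominators, `τ` fixes `1/s` and the iterated
augmentation maps commute with division by `s`: `(τ - id)^j (b/s) = ((σ - id)^j b)/s` [folklore]. -/
theorem iterate_augMap_mk'_of_isLocalization (S : Submonoid B) [IsLocalization S L] {σ : F}
    {τ : G} (h : ∀ b, τ (algebraMap B L b) = algebraMap B L (σ b)) (hS : ∀ s ∈ S, σ s = s)
    (j : ℕ) (b : B) (s : S) :
    (⇑(augMap τ))^[j] (IsLocalization.mk' L b s) =
      IsLocalization.mk' L ((⇑(augMap σ))^[j] b) s := by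
  set w : L := IsLocalization.mk' L 1 s with hw
  have hws : algebraMap B L s * w = 1 := by
    rw [mul_comm, hw, IsLocalization.mk'_spec, map_one]
  have hτs : τ (algebraMap B L s) = algebraMap B L s := by rw [h, hS s s.2]
  have hτw : τ w = w := by
    calc τ w = τ w * (algebraMap B L s * w) := by rw [hws, mul_one]
      _ = τ (w * algebraMap B L s) * w := by rw [map_mul, hτs, mul_assoc]
      _ = w := by rw [mul_comm w, hws, map_one, one_mul]
  rw [IsLocalization.mk'_eq_mul_mk'_one, ← hw, iterate_augMap_mul_of_apply_eq τ hτw,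
    ← semiconj_iterate_augMap h]
  exact (IsLocalization.mk'_eq_mul_mk'_one _ _).symm

end Localization

end Literature.AlgebraicGeometry.Resolution
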